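import Literature.MathematicalPhysics.QuantumFieldTheory.Balaban1983to89.T3DescentSection
import Literature.MathematicalPhysics.QuantumFieldTheory.Balaban1983to89.BlockAveragingSectionAction
import HarnessLib

/-!
# `Balaban1983to89.T3SectionAction` — rung R3, crux K1: A-PRIORI GROWTH of the constrained minimal action under cut-off refinement,
# `minAction_{n,K}(V) ≤ L^{K−n}·A(V)` and `minAction_{n,K+1}(V) ≤ L · minAction_{n,K}(V)` (d = 3)

Cell `ym3-torus` (HUMAN RULING D-0037, YM ladder rung R3), seat `ym3-torus-p1` gen 4 (cell record HOME/UV3-NODE.md §11).  The iterated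
face section `BlockAveragingSectionAction.iterSec` inverts the descent `D_{n,K}` with action `(L^{d−2})^{K−n}·A = L^{K−n}·A` (`d = 3`), so
`minAction_{n,K}(V) ≤ L^{K−n}·A(V)` (`minAction_le_pow_mul`); by the fibre tower (`T3DescentSection`) this propagates to
**`minAction_{n,K+1}(V) ≤ L·minAction_{n,K}(V)`** (`minAction_succ_le_mul`), i.e. `β_{K+1}·minAction_{n,K+1}(V) ≤ L²·β_K·minAction_{n,K}(V)`:
the UPPER half of `MinimiserStabilityAt` holds a priori with the multiplicative constant `L² = L^{d−1}` in place of the crux's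
`1 + (summable)`.  Elementary; no estimate.
-/

noncomputable section

open Literature.MathematicalPhysics.QuantumFieldTheory.Balaban1983to89.T3ContinuumYM3Torus
open Literature.MathematicalPhysics.QuantumFieldTheory.Balaban1983to89.T3LevelShift
open Literature.MathematicalPhysics.QuantumFieldTheory.Balaban1983to89.T3UnitLawDensityEML (ℰp)
open Literature.MathematicalPhysics.QuantumFieldTheory.Balaban1983to89.T3TiltDescent
open Literature.MathematicalPhysics.QuantumFieldTheory.Balaban1983to89.T3ConstrainedMinimiser
open Literature.MathematicalPhysics.QuantumFieldTheory.Balaban1983to89.T3DescentFibreTower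
open Literature.MathematicalPhysics.QuantumFieldTheory.Balaban1983to89.T3DescentSection
open Literature.MathematicalPhysics.QuantumFieldTheory.Balaban1983to89.BlockAveragingSection
open Literature.MathematicalPhysics.QuantumFieldTheory.Balaban1983to89.BlockAveragingSectionAction

namespace Literature.MathematicalPhysics.QuantumFieldTheory.Balaban1983to89.T3SectionAction

variable (F : T3Family) {G : Type*} [GaugeGroup G] (ℰ : LoopAverage G)

/-- **`minAction_{n,K}(V) ≤ L^{K−n}·A(V)`**: the iterated face section of `V` (through the level identification) is a competitor in the
fibre of `V` with action `L^{K−n}·A(V)` (`d = 3`; every `ℰ` with `ℰ(1,…,1) = 1`). [cite: Balaban1987RG1, (0.2)/(0.11) p.252] -/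
theorem minAction_le_pow_mul (hE : ∀ n : ℕ, ℰ.E (fun _ : Fin (n + 1) => (1 : G)) = 1) {n K : ℕ} (h : n ≤ K)
    (V : GaugeField (F.P n) 0 G) : minAction F ℰ n K h V ≤ (F.L : ℝ) ^ (K - n) * wilsonAction4 V := by
  have hk : K - n ≤ (F.PP F.m K).m + (F.PP F.m K).K := by show K - n ≤ F.m + K; omega
  let e := F.sitesPerDir_eq (m := F.m) (K := K) (j := K - n) (m' := F.m) (K' := n) (j' := 0) (by omega)
  let U : GaugeField (F.PP F.m K) 0 G := iterSec (K - n) (fieldShift e V)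
  have hU : U ∈ fibre F ℰ n K h V := by
    show fieldShift _ (Averaging.iter (fun i => BlockAveraging.blockAvg (P := F.PP F.m K) (j := i) ℰ) (K - n) U) = V
    rw [iter_iterSec ℰ hE (K - n) hk, fieldShift_fieldShift]
    exact fieldShift_refl _ _
  have hA : wilsonAction4 U = (F.L : ℝ) ^ (K - n) * wilsonAction4 V := by
    show wilsonAction4 (iterSec (K - n) (fieldShift e V)) = _
    rw [wilsonAction4_iterSec (K - n) hk, wilsonAction4_fieldShift]
    show (((F.L : ℕ) : ℝ) ^ (3 - 2)) ^ (K - n) * wilsonAction4 V = _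
    norm_num
  exact (minAction_le F ℰ hU).trans_eq hA

/-- In particular for ONE step: `minAction_{K,K+1}(W) ≤ L·A(W)`. [cite: Balaban1987RG1, (0.2)/(0.4) p.252] -/
theorem minAction_step_le (hE : ∀ n : ℕ, ℰ.E (fun _ : Fin (n + 1) => (1 : G)) = 1) (K : ℕ) (W : GaugeField (F.P K) 0 G) :
    minAction F ℰ K (K + 1) (Nat.le_succ K) W ≤ F.L * wilsonAction4 W := by
  have h := minAction_le_pow_mul F ℰ hE (Nat.le_succ K) W
  rwa [show K + 1 - K = 1 by omega, pow_one] at h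

/-- **A-PRIORI GROWTH UNDER REFINEMENT**: `minAction_{n,K+1}(V) ≤ L · minAction_{n,K}(V)` (fibre tower + the one-step bound; every
`ℰ` with `ℰ(1,…,1) = 1`).  With `β_{K+1} = L·β_K`: `β_{K+1}·minAction_{n,K+1} ≤ L²·β_K·minAction_{n,K}`. [cite: Balaban1985UV3, (41)-(42) p.266] -/
theorem minAction_succ_le_mul (hE : ∀ n : ℕ, ℰ.E (fun _ : Fin (n + 1) => (1 : G)) = 1) {n K : ℕ} (h : n ≤ K)
    (V : GaugeField (F.P n) 0 G) :
    minAction F ℰ n (K + 1) (h.trans (Nat.le_succ K)) V ≤ F.L * minAction F ℰ n K h V := by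
  have hL : (0 : ℝ) < F.L := by have := F.hL.2; exact_mod_cast (by omega : 0 < F.L)
  -- for every `W` in the `(n,K)`-fibre: `minAction_{n,K+1}(V) ≤ minAction_{K,K+1}(W) ≤ L·A(W)`
  have key : ∀ W ∈ fibre F ℰ n K h V, minAction F ℰ n (K + 1) (h.trans (Nat.le_succ K)) V / F.L ≤ wilsonAction4 W := by
    intro W hW
    rw [div_le_iff₀ hL, mul_comm]
    refine le_trans (le_csInf ((fibre_nonempty F ℰ hE (Nat.le_succ K) W).image _) ?_) (minAction_step_le F ℰ hE K W)
    rintro _ ⟨U, hU, rfl⟩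
    exact minAction_le F ℰ (mem_fibre_trans F ℰ h (Nat.le_succ K) hU hW)
  have h2 : minAction F ℰ n (K + 1) (h.trans (Nat.le_succ K)) V / F.L ≤ minAction F ℰ n K h V :=
    le_csInf ((fibre_nonempty F ℰ hE h V).image _) (by rintro _ ⟨W, hW, rfl⟩; exact key W hW)
  rwa [div_le_iff₀ hL, mul_comm] at h2

/-- The same at the printed smearing, hypothesis-free. [cite: Balaban1985UV3, (41)-(42) p.266] -/
theorem minAction_succ_le_mul_ℰp {n K : ℕ} (h : n ≤ K) (V : GaugeField (F.P n) 0 (Matrix.specialUnitaryGroup (Fin 2) ℂ)) :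
    minAction F ℰp n (K + 1) (h.trans (Nat.le_succ K)) V ≤ F.L * minAction F ℰp n K h V :=
  minAction_succ_le_mul F ℰp expMeanLogSU_E_one h V

end Literature.MathematicalPhysics.QuantumFieldTheory.Balaban1983to89.T3SectionAction

end
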